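import Literature.Analysis.FluidPDE.SereginSverakPressureProofs
import Literature.Analysis.FluidPDE.ConstantinDirectionDissipationProofs
import HarnessLib
import Mathlib

/-!
# StableStrataDoorClassSlabLevels — classical Leray–Hopf solutions: EXPLICIT slab levels of `∇u ∈ L²`, `u ∈ L³`,
# `q̃ ∈ L^{3/2}` in terms of the CLASS constants (initial energy `E₀`, viscosity `ν`, life span `T`)

Helper file of the door family of LADDER-NS N0 (input F2 of I1⋆ `LocalPointZoomAcrossSolutionsM`, class-uniform one-time
doors; `--supports stmt-NavierStokesRegularity-0056`; nsreg-p6 g15).  Theorems only.  For a classical solution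
`(u, p)` of Navier–Stokes (`ν > 0`, `f = 0`) on `[0, T) × ℝ³` which is Leray–Hopf on `[0, T)` with
`½‖u(0)‖₂² ≤ E₀`, the tree proves the FINITENESS of `∬_{(0,T)×ℝ³} |∇u|²`, `∬ |u|³` and `∬ |q̃|^{3/2}`
(`q̃ = p − (p(·,0) − p̃[u](0))` the gauged pressure) — `SereginSverak2002.lintegral_slab_enorm_pow_three_lt_top`,
`….lintegral_slab_gauged_pressure_lt_top`, `SereginSverak2002.lintegral_slab_frobeniusNormSq_fderiv_lt_top'`.  Their
proofs are quantitative; this file records the LEVELS as explicit functions of `(E₀, ν, T)`: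

* `lintegral_slab_frobeniusNormSq_fderiv_le` — `∬ |∇u|²_F ≤ E₀/ν` (energy inequality, Leray 1934 / Constantin 1990
  (2.21), tree `IsLerayHopfOn.lintegral_frobeniusNormSq_fderiv_of_classical`);
* `lintegral_lintegral_enorm_pow_three_le` / `lintegral_slab_enorm_pow_three_le` —
  `∫₀ᵀ∫|u|³ ≤ (2E₀)^{3/4} K_S^{3/2} (T + E₀/ν)` (`‖v‖₃ ≤ ‖v‖₂^{1/2}‖v‖₆^{1/2}`, Sobolev `‖v‖₆ ≤ K_S‖∇v‖₂`,
  `D^{3/4} ≤ 1 + D`; tree `lintegral_enorm_pow_three_le_of_hasWeakGradient`);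
* `lintegral_slab_gauged_pressure_le` — `∬ |q̃|^{3/2} ≤ C_{3/2}^{3/2} (2E₀)^{3/4} K_S^{3/2} (T + E₀/ν)` (Stein's bound
  slice-wise, `lintegral_normalisedPressure_rpow_le`, on the a.e. slices where `q̃ = p̃[u]`).

Use: class-uniform compactness over families of solutions with the same `(T, ν, E₀)` (the local point zoom ACROSS
solutions of one class).  WHAT THIS IS NOT: not NS regularity; energy-class bookkeeping only; no route, no item.

## References

* J. Leray, Acta Math. 63 (1934), §31 (energy inequality). [Leray1934]
* P. Constantin, Comm. Math. Phys. 129 (1990), (2.21). [Constantin1990]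
* E. M. Stein, *Singular Integrals* (1970), Ch. II §4.2 Thm. 3. [Stein1971]
* G. Seregin, V. Šverák, Arch. Ration. Mech. Anal. 163 (2002) (the gauge and the slab class). [SereginSverak2002]
-/

noncomputable section

open MeasureTheory Set Function Filter Topology TopologicalSpace Metric
open scoped NNReal ENNReal

set_option linter.dupNamespace false

namespace Summit.NavierStokesRegularity.NavierStokesRegularity.Theorems.StableStrataDoorClassSlabLevels

open Literature.Analysis Literature.Analysis.FluidPDE Literature.Analysis.FluidPDE.SereginSverak2002

variable {ν T : ℝ} {u : ℝ → (EuclideanSpace ℝ (Fin 3)) → (EuclideanSpace ℝ (Fin 3))}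
  {p : ℝ → (EuclideanSpace ℝ (Fin 3)) → ℝ}

/-- **Dissipation level**: `∬_{(0,T)×ℝ³} |∇u|²_F ≤ E₀/ν` for a classical Leray–Hopf solution with initial kinetic
energy `≤ E₀` (the energy inequality from `s = 0`; the classical gradient is the Leray–Hopf weak gradient a.e.). (Constantin 1990 (2.21)). -/
theorem lintegral_slab_frobeniusNormSq_fderiv_le (hν : 0 < ν) (hT : 0 < T)
    (hsol : IsClassicalNSSolutionOn (Ico 0 T) ν 0 u p) (hLH : IsLerayHopfOn T ν 0 (u 0) u)
    {E₀ : ℝ} (hE₀ : VectorCalculus.kineticEnergy (u 0) ≤ E₀) :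
    ∫⁻ z in Ioo 0 T ×ˢ (univ : Set (EuclideanSpace ℝ (Fin 3))),
        ENNReal.ofReal (frobeniusNormSq (fderiv ℝ (u z.1) z.2)) ≤ ENNReal.ofReal (E₀ / ν) := by
  obtain ⟨hfin, hEI⟩ := hLH.lintegral_frobeniusNormSq_fderiv_of_classical hsol hT
  refine (lintegral_slab_le_lintegral_lintegral _ _).trans ?_
  rw [← ENNReal.ofReal_toReal hfin]
  refine ENNReal.ofReal_le_ofReal ?_
  rw [le_div_iff₀ hν, mul_comm]
  exact hEI.trans hE₀

/-- **Cubic level, iterated form**: `∫₀ᵀ ∫ |u|³ ≤ (2E₀)^{3/4} K_S^{3/2} (T + E₀/ν)` (`K_S` the Sobolev constant of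
`‖v‖₆ ≤ K_S ‖∇v‖₂` on `ℝ³`). -/
theorem lintegral_lintegral_enorm_pow_three_le (hν : 0 < ν) (hT : 0 < T)
    (hsol : IsClassicalNSSolutionOn (Ico 0 T) ν 0 u p) (hLH : IsLerayHopfOn T ν 0 (u 0) u)
    {E₀ : ℝ} (hE₀ : VectorCalculus.kineticEnergy (u 0) ≤ E₀) :
    ∫⁻ t in Ioo 0 T, ∫⁻ x, ‖u t x‖ₑ ^ (3 : ℕ) ≤
      ENNReal.ofReal (2 * E₀) ^ (3 / 4 : ℝ) *
        ((SNormLESNormFDerivOfEqConst (EuclideanSpace ℝ (Fin 3))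
            (volume : Measure (EuclideanSpace ℝ (Fin 3))) 2 : ℝ≥0∞) ^ (3 / 2 : ℝ) *
          (ENNReal.ofReal T + ENNReal.ofReal (E₀ / ν))) := by
  set A : ℝ≥0∞ := ENNReal.ofReal (2 * E₀) with hA
  set K : ℝ≥0∞ :=
    (SNormLESNormFDerivOfEqConst (EuclideanSpace ℝ (Fin 3))
      (volume : Measure (EuclideanSpace ℝ (Fin 3))) 2 : ℝ≥0∞) with hK
  set D : ℝ → ℝ≥0∞ := fun t => ∫⁻ x, ENNReal.ofReal (frobeniusNormSq (fderiv ℝ (u t) x)) with hDdef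
  have hc : A ^ (3 / 4 : ℝ) * K ^ (3 / 2 : ℝ) ≠ ⊤ :=
    ENNReal.mul_ne_top (ENNReal.rpow_ne_top_of_nonneg (by norm_num) ENNReal.ofReal_ne_top)
      (ENNReal.rpow_ne_top_of_nonneg (by norm_num) ENNReal.coe_ne_top)
  -- slice bound at every `t ∈ (0, T)` through the classical gradient
  have hslice : ∀ t ∈ Ioo 0 T, ∫⁻ x, ‖u t x‖ₑ ^ (3 : ℕ) ≤ A ^ (3 / 4 : ℝ) * K ^ (3 / 2 : ℝ) * (1 + D t) := by
    intro t ht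
    have htc : t ∈ Icc 0 T := ⟨ht.1.le, ht.2.le⟩
    have hmem : MemLp (u t) 2 volume := hLH.memLp t htc
    have hAt : ∫⁻ x, ‖u t x‖ₑ ^ 2 ≤ A := by
      refine (eEnergy_le hν.le hLH htc).trans ?_
      rw [hA]
      exact ENNReal.ofReal_le_ofReal (by linarith)
    have hu1 : ContDiff ℝ 1 (u t) :=
      (hsol.contDiff_velocity ⟨ht.1.le, ht.2⟩).of_le (by exact_mod_cast le_top)
    have hG : HasWeakGradient (u t) (fderiv ℝ (u t)) := hasWeakGradient_fderiv_of_contDiff hu1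
    refine (lintegral_enorm_pow_three_le_of_hasWeakGradient hmem hG hAt).trans ?_
    rw [mul_assoc]
    gcongr
    exact ENNReal.rpow_three_quarters_le_one_add _
  -- integrate in time
  have hDint : ∫⁻ t in Ioo 0 T, D t ≤ ENNReal.ofReal (E₀ / ν) := by
    obtain ⟨hfin, hEI⟩ := hLH.lintegral_frobeniusNormSq_fderiv_of_classical hsol hT
    rw [← ENNReal.ofReal_toReal hfin]
    refine ENNReal.ofReal_le_ofReal ?_
    rw [le_div_iff₀ hν, mul_comm]
    exact hEI.trans hE₀
  calc ∫⁻ t in Ioo 0 T, ∫⁻ x, ‖u t x‖ₑ ^ (3 : ℕ)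
      ≤ ∫⁻ t in Ioo 0 T, A ^ (3 / 4 : ℝ) * K ^ (3 / 2 : ℝ) * (1 + D t) :=
        setLIntegral_mono' measurableSet_Ioo fun t ht => hslice t ht
    _ = A ^ (3 / 4 : ℝ) * K ^ (3 / 2 : ℝ) * (volume (Ioo (0 : ℝ) T) + ∫⁻ t in Ioo 0 T, D t) := by
        rw [lintegral_const_mul' _ _ hc, lintegral_add_left measurable_const, setLIntegral_const, one_mul]
    _ ≤ A ^ (3 / 4 : ℝ) * (K ^ (3 / 2 : ℝ) * (ENNReal.ofReal T + ENNReal.ofReal (E₀ / ν))) := by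
        rw [Real.volume_Ioo, sub_zero, mul_assoc]
        gcongr

/-- **Cubic level on the slab**: `∬_{(0,T)×ℝ³} |u|³ ≤ (2E₀)^{3/4} K_S^{3/2} (T + E₀/ν)` (Tonelli's inequality and the
iterated bound). -/
theorem lintegral_slab_enorm_pow_three_le (hν : 0 < ν) (hT : 0 < T)
    (hsol : IsClassicalNSSolutionOn (Ico 0 T) ν 0 u p) (hLH : IsLerayHopfOn T ν 0 (u 0) u)
    {E₀ : ℝ} (hE₀ : VectorCalculus.kineticEnergy (u 0) ≤ E₀) :
    ∫⁻ z in Ioo 0 T ×ˢ (univ : Set (EuclideanSpace ℝ (Fin 3))), ‖u z.1 z.2‖ₑ ^ (3 : ℕ) ≤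
      ENNReal.ofReal (2 * E₀) ^ (3 / 4 : ℝ) *
        ((SNormLESNormFDerivOfEqConst (EuclideanSpace ℝ (Fin 3))
            (volume : Measure (EuclideanSpace ℝ (Fin 3))) 2 : ℝ≥0∞) ^ (3 / 2 : ℝ) *
          (ENNReal.ofReal T + ENNReal.ofReal (E₀ / ν))) :=
  (lintegral_slab_le_lintegral_lintegral _ _).trans (lintegral_lintegral_enorm_pow_three_le hν hT hsol hLH hE₀)

/-- **Pressure level on the slab**: the gauged pressure `q̃ = p − (p(·,0) − p̃[u](0))` of a classical Leray–Hopf solution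
satisfies `∬_{(0,T)×ℝ³} |q̃|^{3/2} ≤ C_{3/2}^{3/2} (2E₀)^{3/4} K_S^{3/2} (T + E₀/ν)` (`q̃(t) = p̃[u(t)]` for a.e. `t`, Stein's
`L^{3/2}` bound slice-wise, and the cubic level). (Stein 1970, Ch. II §4.2 Thm. 3). -/
theorem lintegral_slab_gauged_pressure_le (hν : 0 < ν) (hT : 0 < T)
    (hsol : IsClassicalNSSolutionOn (Ico 0 T) ν 0 u p) (hLH : IsLerayHopfOn T ν 0 (u 0) u)
    {E₀ : ℝ} (hE₀ : VectorCalculus.kineticEnergy (u 0) ≤ E₀) :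
    ∫⁻ z in Ioo 0 T ×ˢ (univ : Set (EuclideanSpace ℝ (Fin 3))),
        ‖p z.1 z.2 - (p z.1 0 - normalisedPressure (u z.1) 0)‖ₑ ^ (3 / 2 : ℝ) ≤
      (steinConstThreeHalves : ℝ≥0∞) ^ (3 / 2 : ℝ) *
        (ENNReal.ofReal (2 * E₀) ^ (3 / 4 : ℝ) *
          ((SNormLESNormFDerivOfEqConst (EuclideanSpace ℝ (Fin 3))
              (volume : Measure (EuclideanSpace ℝ (Fin 3))) 2 : ℝ≥0∞) ^ (3 / 2 : ℝ) *
            (ENNReal.ofReal T + ENNReal.ofReal (E₀ / ν)))) := by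
  obtain ⟨hgauge, -⟩ := exists_pressure_gauge_of_classical hν hT hsol hLH
  set C₀ : ℝ≥0∞ := (steinConstThreeHalves : ℝ≥0∞) ^ (3 / 2 : ℝ) with hC₀
  have hC₀t : C₀ ≠ ⊤ := ENNReal.rpow_ne_top_of_nonneg (by norm_num) ENNReal.coe_ne_top
  have hslice' : ∀ᵐ t ∂(volume.restrict (Ioo 0 T)),
      ∫⁻ x, ‖p t x - (p t 0 - normalisedPressure (u t) 0)‖ₑ ^ (3 / 2 : ℝ) ≤
        C₀ * ∫⁻ x, ‖u t x‖ₑ ^ (3 : ℕ) := by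
    filter_upwards [hgauge, ae_restrict_mem measurableSet_Ioo] with t ht htI
    have hsm : ContDiff ℝ (⊤ : ℕ∞) (u t) := hsol.contDiff_velocity ⟨htI.1.le, htI.2⟩
    have hL2 : Integrable fun y => ‖u t y‖ ^ 2 :=
      (hLH.memLp t ⟨htI.1.le, htI.2.le⟩).integrable_norm_pow two_ne_zero
    calc ∫⁻ x, ‖p t x - (p t 0 - normalisedPressure (u t) 0)‖ₑ ^ (3 / 2 : ℝ)
        = ∫⁻ x, ‖normalisedPressure (u t) x‖ₑ ^ (3 / 2 : ℝ) := by simp_rw [ht]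
      _ ≤ C₀ * ∫⁻ x, ‖u t x‖ₑ ^ (3 : ℕ) := lintegral_normalisedPressure_rpow_le hsm hL2
  refine (lintegral_slab_le_lintegral_lintegral _ _).trans ?_
  calc ∫⁻ t in Ioo 0 T, ∫⁻ x, ‖p t x - (p t 0 - normalisedPressure (u t) 0)‖ₑ ^ (3 / 2 : ℝ)
      ≤ ∫⁻ t in Ioo 0 T, C₀ * ∫⁻ x, ‖u t x‖ₑ ^ (3 : ℕ) := lintegral_mono_ae hslice'
    _ = C₀ * ∫⁻ t in Ioo 0 T, ∫⁻ x, ‖u t x‖ₑ ^ (3 : ℕ) := by rw [lintegral_const_mul' _ _ hC₀t]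
    _ ≤ C₀ * _ := by
        gcongr
        exact lintegral_lintegral_enorm_pow_three_le hν hT hsol hLH hE₀

end Summit.NavierStokesRegularity.NavierStokesRegularity.Theorems.StableStrataDoorClassSlabLevels

end
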